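import Summits.QuantumFields.BalabanUV.T4Continuum.Support.VariationalTaxiTower
import Summits.QuantumFields.BalabanUV.T4Continuum.Support.VariationalTaxiNestedTower
import Summits.QuantumFields.BalabanUV.T4Continuum.Support.VariationalCovariantEndRel

/-!
# T⁴ programme, spine node NE2 (U1a), lane P2 — SUPPORT: THE COHERENT TAXI TOWER (U(1)), PART 2 — THE TAXI TOWER END: the road owner's
# repaired END `towerLimitRate_scalarTower_closed_rel` INHABITED by the nested taxi tower over a coherent tower of unit lattice phases with
# ONE scale-invariant plaquette bound

NE2 formalisation swarm `b2b-balaban-t4-ne2-formalise-*`, leaf 04 GEN 3 (`prover-b2b-balaban-t4-ne2-formalise-leaf-04-g3-0`); register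
P2-sup item (O7) «TAXI TOWER END» (road owner `t4-ne2-p2` gen 11: OPEN SUPPLIER ITEMS CLAIMS.log l.10301, GO l.11188; INTENT l.11043).

WHAT.  `VariationalCovariantEndRel.towerLimitRate_scalarTower_closed_rel` (p215080; the located finding N-ne2p2g11-2 ≡ G-ne2leaf04g2-1 repaired
by UB⁺ RELATIVE TO A REFERENCE TRANSPORT) displays, besides the P⁺ frames, some thirty binders on the tower data `(Rc, T, T₀, R′, T′)` and the
defect families `(w, w′, a, m, m₁)` with their CLASS.  THIS FILE discharges ALL OF THEM for the COHERENT TAXI TOWER (PART 1 `VariationalTaxiTower`,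
p215258): `Rc k := coarseT L (fine (L^k) M) (R′ k)` (straight `L`-bond coarsening), `T k := nestT L M R′ k` (nested taxi contours, COMP⁺ by `rfl`),
`T₀ k := taxiT (L^k) M (Rc k)` (straight taxi reference), `T′ k := taxiT L (fine (L^k) M) (R′ k)` (one-step taxi) — from FOUR data hypotheses:
  (i) unit one-step phases `‖R′ k x μ‖ = 1`;  (ii) plaquette defects `‖plaq (R′ k) − 1‖ ≤ a′_k` with ONE scale-invariant CLASS line
  `(L^k·L)²·a′_k ≤ c`;  (iii) COHERENCE `coarseT L (fine (L^(k+1)) M) (R′ (k+1)) = Rtr (L^k) L M (R′ k)`;  (iv) TWO smallness lines on `c`: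
  `512d²((d−1)c)² ≤ ½` (FED⁺ absorption) and `4d²c < 1` (the relative phase `γ = 4d²c` of leaf-01-g4's (O10) `VariationalTaxiNestedTower.tower_hrel`,
  fed with `hTcomp := fun _ => rfl` and `h0 := nestT_zero_rel`, is `< 1`),
plus the mass `a₀ > 0` and `2 ≤ L`.  CONCLUSION (`towerLimitRate_taxiTower_of_frames`):
  `TowerLimitRate (fun _ ↦ 1) 1 (fun k => effSc (L^k) M (coarseT L (fine (L^k) M) (R′ k)) (nestT L M R′ k) a₀) (cEnd d L c_w′ c (d−1)c (d−1)c) L⁻¹`,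
  `c_w′ = (4 + (d−1)c)/(1 − 4d²c)`.
The TEN P⁺ frame binders of p215080 (global small-field frames `G, c, G′, c′` at every level with `16d²(n·m_G)² + 4m_B² ≤ ½`) are DISPLAYED
VERBATIM here: they are NOT constructible from the plaquette class for curved data (an axial frame pays the holonomy of loops of area ≍ n²
plaquettes), which is why the road owner files the frame-free `…EndLocal` on leaf-01-g4's `VariationalCovariantPoincareLocal` ∕
`…ScalarPairLocal`; the frame-free twin of this theorem follows it (same four data hypotheses + the local smallness lines).  A NON-FLAT inhabitant
of (i)–(iii) with `c = 2πq/(M μ₀ M μ₁)` is PART 3 (`VariationalTaxiTowerFlux` ∕ `…FluxTower`: `q` flux quanta through one torus plane).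

HONEST FRAMING (T4-DAG p. 1).  Instantiation ∕ bookkeeping at MODEL level (U(1) charged scalar; abelian taxi ∕ straight contours; OUR typed
objects; [Balaban1985BackgroundPropagators] (3.15) ∕ (3.19) p.393 SHAPES only — the non-abelian ordered products are untouched); GLOBAL small-field
frames still displayed in this file; [folklore]; nothing printed is a hypothesis; no `def`; no `def … : Prop`; no `sorry`; axioms standard.  NOT tier B,
NOT NE2⁺ as printed; NE2 NOT proved on either road; spine 0/9; rung (B)+1 finite T⁴ — NOT infinite volume, NOT mass gap, NOT Clay.  HONEST
DEPENDENCY (cell, verbatim): continuum YM on T⁴ ⇐ BetaPertH ∧ nine spine estimates (0/9 proved); BetaPertH ⇐ (D1) ∧ (D4) ∧ CAP+tail;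
G-an2-4 gates asym, D1 and NE2/3/4.
-/

noncomputable section

open scoped Matrix ComplexConjugate ComplexOrder Matrix.Norms.L2Operator BigOperators

namespace Summit.QuantumFields.BalabanUV.T4Continuum.VariationalTaxiTowerEnd

open Literature.MathematicalPhysics.QuantumFieldTheory.Balaban1983to89.B5Prop11Plancherel (Tor fine unitVec)
open Literature.MathematicalPhysics.QuantumFieldTheory.Balaban1983to89.B5Block118 (bpt)
open Summit.QuantumFields.BalabanUV.T4Continuum.VariationalCovariantEffective (effSc)
open Summit.QuantumFields.BalabanUV.T4Continuum.VariationalCovariantTower (compT Rtr)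
open Summit.QuantumFields.BalabanUV.T4Continuum.VariationalCovariantEnd (cEnd)
open Summit.QuantumFields.BalabanUV.T4Continuum.VariationalCovariantEndRel (towerLimitRate_scalarTower_closed_rel)
open Summit.QuantumFields.BalabanUV.T4Continuum.CovariantAveragingTower (TowerLimitRate)
open Summit.QuantumFields.BalabanUV.T4Continuum.VariationalTaxiTransport
open Summit.QuantumFields.BalabanUV.T4Continuum.VariationalTaxiCoarse
open Summit.QuantumFields.BalabanUV.T4Continuum.VariationalTaxiTower
open Summit.QuantumFields.BalabanUV.T4Continuum.VariationalTaxiNestedTower (tower_hrel)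

variable {d : ℕ} (L : ℕ) [NeZero L] (M : Fin d → ℕ) [hM : ∀ μ, NeZero (M μ)]

/-- **THE RELATIVE PHASE OF THE NESTED TAXI TOWER** ((O10) `tower_hrel` at `T := nestT`, `hTcomp := rfl`, `γ₀ := 0` by `nestT_zero_rel`):
`‖nestT k x·conj (taxiT (L^k) M (Rc k) x) − 1‖ ≤ 4d²·c` — the END's `hrel` binder for taxi data, k-UNIFORM. [folklore] -/
theorem hrel_taxiTower (hL : 2 ≤ L)
    {R' : (k : ℕ) → Tor (fine L (fine (L ^ k) M)) → Fin d → ℂ} (hR1 : ∀ k x μ, ‖R' k x μ‖ = 1)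
    {a' : ℕ → ℝ} (ha0 : ∀ k, 0 ≤ a' k) (ha' : ∀ k x κ ι, ‖plaq L (fine (L ^ k) M) (R' k) x κ ι - 1‖ ≤ a' k)
    {c : ℝ} (hclass : ∀ k, ((((L ^ k : ℕ)) : ℝ) * L) ^ 2 * a' k ≤ c)
    (hcoh : ∀ k, coarseT L (fine (L ^ (k + 1)) M) (R' (k + 1)) = Rtr (L ^ k) L M (R' k)) (k : ℕ) (x : Tor (fine (L ^ k) M)) :
    ‖nestT L M R' k x * conj (taxiT (L ^ k) M (coarseT L (fine (L ^ k) M) (R' k)) x) - 1‖ ≤ 4 * (d : ℝ) ^ 2 * c := by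
  have h := tower_hrel L M hL hR1 ha0 ha' hclass hcoh (norm_nestT L M hR1) (nestT_succ L M R')
    (γ₀ := 0) (fun x => (nestT_zero_rel L M hR1 x).le) k x
  linarith

/-- **THE TAXI TOWER END (frames displayed).**  The road owner's `towerLimitRate_scalarTower_closed_rel` (p215080) for the COHERENT TAXI TOWER —
every tower ∕ defect ∕ class binder DISCHARGED from: unit one-step phases `R′ k`, plaquette defects `a′_k` with `(L^k·L)²·a′_k ≤ c`, coherence,
`512d²((d−1)c)² ≤ ½`, `4d²c < 1`, `0 < a₀`, `2 ≤ L`; the ten global-frame binders of p215080 displayed verbatim (removed in the `…EndLocal` twin).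
Model level; NE2 NOT proved. [folklore] -/
theorem towerLimitRate_taxiTower_of_frames (hL : 2 ≤ L)
    -- the coherent tower of unit lattice phases and its plaquette class
    {R' : (k : ℕ) → Tor (fine L (fine (L ^ k) M)) → Fin d → ℂ} (hR1 : ∀ k x μ, ‖R' k x μ‖ = 1)
    {a' : ℕ → ℝ} (ha0 : ∀ k, 0 ≤ a' k) (ha' : ∀ k x κ ι, ‖plaq L (fine (L ^ k) M) (R' k) x κ ι - 1‖ ≤ a' k)
    (hcoh : ∀ k, coarseT L (fine (L ^ (k + 1)) M) (R' (k + 1)) = Rtr (L ^ k) L M (R' k))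
    {c : ℝ} (hclass : ∀ k, ((((L ^ k : ℕ)) : ℝ) * L) ^ 2 * a' k ≤ c)
    (hcabs : 512 * (d : ℝ) ^ 2 * (((d - 1 : ℕ) : ℝ) * c) ^ 2 ≤ 1 / 2) (hcγ : 4 * (d : ℝ) ^ 2 * c < 1)
    -- P⁺ frames (displayed; NOT constructible from the plaquette class — removed by the `…EndLocal` twin)
    {G : (k : ℕ) → Tor (fine (L ^ k) M) → ℂ} {cf : (k : ℕ) → Tor M → ℂ} {mG mB : ℕ → ℝ}
    (hG : ∀ k x, ‖G k x‖ = 1) (hc : ∀ k z, ‖cf k z‖ ≤ 1)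
    (hframe : ∀ k x μ, ‖G k (x + unitVec (fine (L ^ k) M) μ) - G k x * coarseT L (fine (L ^ k) M) (R' k) x μ‖ ≤ mG k)
    (hblock : ∀ k z j, ‖G k (bpt (L ^ k) M z j) - cf k z * nestT L M R' k (bpt (L ^ k) M z j)‖ ≤ mB k)
    (hsmall : ∀ k, 16 * (d : ℝ) ^ 2 * ((((L ^ k : ℕ)) : ℝ) * mG k) ^ 2 + 4 * mB k ^ 2 ≤ 1 / 2)
    {G' : (k : ℕ) → Tor (fine L (fine (L ^ k) M)) → ℂ} {cf' : (k : ℕ) → Tor (fine (L ^ k) M) → ℂ} {mG' mB' : ℕ → ℝ}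
    (hG' : ∀ k x, ‖G' k x‖ = 1) (hc' : ∀ k y, ‖cf' k y‖ ≤ 1)
    (hframe' : ∀ k x μ, ‖G' k (x + unitVec (fine L (fine (L ^ k) M)) μ) - G' k x * R' k x μ‖ ≤ mG' k)
    (hblock' : ∀ k y j,
      ‖G' k (bpt L (fine (L ^ k) M) y j) - cf' k y * taxiT L (fine (L ^ k) M) (R' k) (bpt L (fine (L ^ k) M) y j)‖ ≤ mB' k)
    (hsmall' : ∀ k, 16 * (d : ℝ) ^ 2 * ((L : ℝ) * mG' k) ^ 2 + 4 * mB' k ^ 2 ≤ 1 / 2)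
    -- the mass
    {a₀ : ℝ} (ha₀ : 0 < a₀) :
    TowerLimitRate (ι := fun _ => Tor M) (fun _ => (1 : Matrix (Tor M) (Tor M) ℂ)) 1
      (fun k => effSc (L ^ k) M (coarseT L (fine (L ^ k) M) (R' k)) (nestT L M R' k) a₀)
      (cEnd d L ((4 + ((d - 1 : ℕ) : ℝ) * c) / (1 - 4 * (d : ℝ) ^ 2 * c)) c (((d - 1 : ℕ) : ℝ) * c) (((d - 1 : ℕ) : ℝ) * c))
      ((L : ℝ)⁻¹) :=
  towerLimitRate_scalarTower_closed_rel L M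
    (Rc := fun k => coarseT L (fine (L ^ k) M) (R' k)) (T := nestT L M R')
    (T₀ := fun k => taxiT (L ^ k) M (coarseT L (fine (L ^ k) M) (R' k)))
    (R' := R') (T' := fun k => taxiT L (fine (L ^ k) M) (R' k))
    (G := G) (c := cf) (mG := mG) (mB := mB) (G' := G') (c' := cf') (mG' := mG') (mB' := mB')
    (m := fun k => ((d - 1 : ℕ) : ℝ) * ((L : ℝ) * ((L - 1 : ℕ) : ℝ) * a' k))
    (w := fun k => ((d - 1 : ℕ) : ℝ) * ((L ^ k - 1 : ℕ) : ℝ) * ((L : ℝ) * L * a' k))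
    (w' := fun k => (4 + ((d - 1 : ℕ) : ℝ) * c) / (1 - 4 * (d : ℝ) ^ 2 * c) / (((L ^ k : ℕ)) : ℝ))
    (a := fun k => (L : ℝ) * L * a' k)
    (m₁ := fun k => ((d - 1 : ℕ) : ℝ) * ((L - 1 : ℕ) : ℝ) * ((L : ℝ) + 1) * a' k)
    hL (norm_nestT L M hR1) (norm_coarseT_tower L M hR1) (norm_R'_le L M hR1) (norm_taxiT_step L M hR1)
    (fun _ => rfl) (fun k => hcoh k)
    hG hc hframe hblock hsmall hG' hc' hframe' hblock' hsmall'
    (fun k => by have := ha0 k; positivity) (hmis_taxiTower L M hR1 ha') (habsorb_taxiTower L ha0 hclass hcabs)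
    (norm_taxiT_ref L M hR1) (fun k => by have := ha0 k; positivity) (hwin_taxiTower L M hR1 ha') hcγ
    (hrel_taxiTower L M hL hR1 ha0 ha' hclass hcoh)
    (fun k => (hw'_taxiTower (d := d) L ha0 hclass hcγ k).2.2) (fun k => (hw'_taxiTower (d := d) L ha0 hclass hcγ k).1)
    (fun k => by have := ha0 k; positivity) (hP_taxiTower L M hR1 ha')
    (fun k => by have := ha0 k; positivity) (hin_taxiTower L M hR1 ha') (hcross_taxiTower L M hR1 ha')
    (fun k => (hw'_taxiTower (d := d) L ha0 hclass hcγ k).2.1) (fun k => (class_taxiTower (d := d) L ha0 hclass k).2.1)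
    (fun k => (class_taxiTower (d := d) L ha0 hclass k).2.2.1) (fun k => (class_taxiTower (d := d) L ha0 hclass k).2.2.2) ha₀

end Summit.QuantumFields.BalabanUV.T4Continuum.VariationalTaxiTowerEnd

end
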